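import Literature.Barriers.CriticalPhenomena.PlaquetteWalkHoleRootSevenAboveFrameTwo
import Literature.Barriers.CriticalPhenomena.PlaquetteWalkHoleRootRowOnly
import Literature.Barriers.CriticalPhenomena.PlaquetteWalkHoleRootRowLawWitness
import HarnessLib

/-!
# Barrier catalogue (SAWScalingLimit): the cost-`7` vertical-end parents of the level-`5` class-`B2b` members never return to a rhombus WEST of the root
column, off the hole row («NO LEVEL-5 B2b PARENT WEST OF THE ROOT COLUMN, OFF THE HOLE ROW»)

`Z → ∞` limit model of the printed Yang–Baxter weights [GlazmanManolescu2019, §1, eq. (1)]; the «RECTANGLE COEFFICIENT» line of the venture lane «pcv-sawmu»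
(b-engine-1 g28). The level-`5` class-`B2b` members of a `W`-rooted hole are the extensions `ext₃ ω` of the wound class-`B2a` walks `ω` with a turning first arc
in `r` and EITHER limit cost `5` and a slanted end OR limit cost `7` and a vertical end (`ΩG.cost_ext₃_eq_five_iff`). `PlaquetteWalkHoleRootWestColumn` places
the first kind in the root column or east of it; this file does the same for the second kind when `r` lies off the hole row:

* ★★★★ `ΩG.rootCol_le_of_cost_seven_vert_above`: a wound class-`B2a` walk of limit cost `7` from the hole root `w.side W` (hole absent) ending on a VERTICAL
  side of a rhombus `r` STRICTLY ABOVE the root row, with a turning first arc in `r`, has `w.1 ≤ r.1`. THE WALL ARGUMENT: `r` lies in the top row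
  (`top_row_of_cost_seven_vert_above`) and uses `S`; the six isolated turns are `r`, the end of its horizontal chain, a third top-row turn next to the last
  plaquette, two bottom-row turns and the root-row turn `τ = (τ1, w.2)`, `τ1 ≥ w.1`, at the east end of the first turn's chain — so NO plaquette strictly
  between the extreme rows and west of the root column uses `W`, and the south chain of `r` is a straight, singly visited column down to a bottom-row turn:
  with `r.1 < w.1` the column `r.1` is a WALL visited within `Mc` steps of the first hit. The excursion starts on one side of the wall and must end at the
  last plaquette `(r.1 ± 1, r.2)`: either it would have to cross the wall (a column between two columns of consecutive arcs is visited — discrete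
  intermediate values), or the prefix from `w` (east of the wall) would, or the excursion stays west of the wall and never meets the eastern ray behind the
  root mid-edge (`rayCountAt (holeFaceW w) E = 0`, #838 parity law) — against woundness.
* ★★★★ `ΩG.rootCol_le_of_cost_seven_vert_below` (row reflection) and `ΩG.rootCol_le_of_cost_seven_vert_off_row` (`r.2 ≠ w.2`).

Census support: kit j276221 / j298353 (3 455 rooted domains): minimal wound cost `7` at every cell west of the root column off the hole row, so no
cost-`5` extension lives there. [GlazmanManolescu2019 §1 Fig. 1, eq. (1), Lemma 2.1, Remark 2.2; Glazman2015WeightedSAW Lemma 3.1 (proof, pp. 6–7);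
CourantRobbins1958 Ch. V App. §2]
-/

noncomputable section

namespace Literature.Probability.RandomPlanarGeometry.SAW.YangBaxter

open Real
open Literature.Barriers.CriticalPhenomena.PlaquetteWalk

open private fc_fh fh_add_Mv three_le_Mv from Literature.Probability.RandomPlanarGeometry.YangBaxterSAWGeneralDomain


namespace ΩG

variable {D : Set Face} {w r : Face} {ω : ΩG D (w.side .W) r}

/-- A side mid-edge on the eastern ray of the hole belongs to a plaquette of the root column or east of it. [cite: CourantRobbins1958, Ch. V Appendix §2 (the even–odd rule: the ray)] -/
private theorem le_fst_of_eastRayB_side' {w f : Face} {s : Side} (h : eastRayB w (f.side s) = true) : w.1 ≤ f.1 := by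
  obtain ⟨x, y⟩ := f
  cases s <;> simp [Face.side, eastRayB] at h ⊢ <;> omega

/-! ## Cost-`7` vertical-end parents above the root row lie in the root column or east of it -/

/-- The case `ω.1 = E` of `rootCol_le_of_cost_seven_vert_above` (the wall argument). [cite: GlazmanManolescu2019, §1, Fig. 1 and eq. (1); Lemma 2.1; Remark 2.2]
[cite: Glazman2015WeightedSAW, Lemma 3.1 (proof, pp. 6–7)] [cite: CourantRobbins1958, Ch. V Appendix §2 (the even–odd rule)] -/
private theorem not_west_of_cost_seven_E_above (hh : holeFaceW w ∉ D) (hr : RootedFace D (w.side .W) r) (h : ω.IsB2a)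
    (hA : ω.AJ hr h (toC (midPt (w.side .W))) ≠ 0) (hc : cost (slotOfSide ω.1) ω.2.mids = 7) (hωE : ω.1 = .E)
    (hNS : arcKind (ω.2.sIn ω.2.firstHitG) (ω.2.sOut ω.2.firstHitG) ≠ .straight) (habove : w.2 < r.2) (hwest : r.1 < w.1) : False := by
  classical
  set n := ω.2.arcs.length with hn
  have hz : ω.1 = .E ∨ ω.1 = .W := Or.inl hωE
  ---------------------------------------------------------------- basics
  have hF := ω.fh_lt h
  have hlen : 0 < n := by omega
  have h0w : ω.2.fc 0 = w := fc_zero_eq_root w hh ω.2 hlen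
  have h0W : ω.2.sIn 0 = .W := YBWalk.sIn_zero_eq_W hh ω.2 hlen
  have h0E : ω.2.sIn 0 ≠ .E := by rw [h0W]; decide
  have h0S : ω.2.sIn 0 ≠ .S := by rw [h0W]; decide
  have hfcF := (fc_fh ω hr h).1
  have hsvr : ∀ l < n, ω.2.fc l = ω.2.fc ω.2.firstHitG → l = ω.2.firstHitG := fun l hl e => eq_firstHitG_of_fc_eq hr h hl e
  have hfne3 : ω.2.firstHitG + 3 ≤ n := by have := three_le_Mv hr h; have := fh_add_Mv h; unfold ΩG.Mv at *; omega
  have hn1 : n - 1 < n := by omega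
  -- the top row is the row of `r`; `r` uses `S`, not `N`
  have hY : ∀ j < n, (ω.2.fc j).2 ≤ r.2 := top_row_of_cost_seven_vert_above hh hr h hA hc hz hNS habove
  obtain ⟨hrS', hnN1, hnN2⟩ := usesSide_S_of_cost_seven_vert_above hh hr h hA hc hz hNS habove
  have hrS : ω.2.UsesSide r .S := ⟨_, hF, hfcF, hrS'⟩
  have hNtop := forall_top_ne_N hh hr h hY habove
  -- the last plaquette `L = (r.1 + 1, r.2)`, left through `W`
  obtain ⟨hsW, hL⟩ : ω.2.sOut (n - 1) = .W ∧ ω.2.fc (n - 1) = (r.1 + 1, r.2) := by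
    rcases last_of_vertical_end hr h (Or.inl hωE) with ⟨-, h2, h3⟩ | ⟨h1, -, -⟩
    · exact ⟨h2, h3⟩
    · rw [hωE] at h1; exact absurd h1 (by decide)
  -- the side of `r` carrying the end is not used by the arc of `r`: the arc of `r` is `{S, W}`
  have hrside : ∀ s, ω.2.UsesSide r s → r.side s ≠ r.side ω.1 := by
    rintro s ⟨l, hl, hfl, hs⟩ e
    have hl' := hsvr l hl (hfl.trans hfcF.symm)
    obtain ⟨hin, hout⟩ := ω.2.side_sIn_eq_nth hl
    rw [hfl] at hin hout
    rw [← ω.2.nth_length] at e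
    rcases hs with hs | hs
    · rw [hs] at hin; have := ω.2.nth_inj (show l ≤ n by omega) le_rfl (hin.symm.trans e).symm.symm; omega
    · rw [hs] at hout; have := ω.2.nth_inj (show l + 1 ≤ n by omega) le_rfl (hout.symm.trans e).symm.symm; omega
  have hrarc : (ω.2.sIn ω.2.firstHitG = .S ∧ ω.2.sOut ω.2.firstHitG = .W) ∨ (ω.2.sIn ω.2.firstHitG = .W ∧ ω.2.sOut ω.2.firstHitG = .S) := by
    have hne := ω.2.sIn_ne_sOut hF
    have hnoE : ¬(ω.2.sIn ω.2.firstHitG = .E ∨ ω.2.sOut ω.2.firstHitG = .E) := fun hs => hrside .E ⟨_, hF, hfcF, hs⟩ (by rw [hωE])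
    revert hne hnoE hrS' hnN1 hnN2; cases ω.2.sIn ω.2.firstHitG <;> cases ω.2.sOut ω.2.firstHitG <;> decide
  have hrW : ω.2.UsesSide r .W := by
    rcases hrarc with ⟨-, e⟩ | ⟨e, -⟩
    · exact ⟨_, hF, hfcF, Or.inr e⟩
    · exact ⟨_, hF, hfcF, Or.inl e⟩
  ---------------------------------------------------------------- isolated turns: six, as `P`-cells
  have h6 : cfgCount ω.2.mids [.corner] + cfgCount ω.2.mids [.coCorner] = 6 := by
    have hcost : cost (slotOfSide ω.1) ω.2.mids =
        cfgCount ω.2.mids [.corner] + cfgCount ω.2.mids [.coCorner] + (1 - slotDeg (slotOfSide ω.1)) := rfl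
    have hd : slotDeg (slotOfSide ω.1) = 0 := by rw [hωE]; rfl
    rw [hcost, hd] at hc; omega
  let P : Face → Prop := fun f => f ∈ facesL ω.2.mids ∧ (kindsL ω.2.mids f = [.corner] ∨ kindsL ω.2.mids f = [.coCorner])
  have hPiso : ∀ k < n, (∀ l < n, ω.2.fc l = ω.2.fc k → l = k) → arcKind (ω.2.sIn k) (ω.2.sOut k) ≠ .straight → P (ω.2.fc k) :=
    fun k hk hsv hkind => isolated_turn hk hsv hkind
  have hle6 : ∀ T : Finset Face, (∀ f ∈ T, P f) → T.card ≤ 6 := by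
    intro T hT; have := YBWalk.card_le_cfgCount_add ω.2.mids T hT; omega
  have hPr : P r := by have := hPiso _ hF hsvr hNS; rwa [hfcF] at this
  -- two bottom-row turns `b₁ ≠ b₂`
  obtain ⟨Y', hY'w, hY', Tb, hTbP, hTbrow, hTbcard⟩ := two_bottom_turns hh hr h hA
  have hTb2 : 1 < Tb.card := by
    rcases hTbcard with h2 | ⟨-, -, hrY⟩
    · omega
    · exfalso; omega
  obtain ⟨b₁, hb₁, b₂, hb₂, hb12⟩ := Finset.one_lt_card.1 hTb2
  have hPb₁ : P b₁ := hTbP b₁ hb₁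
  have hPb₂ : P b₂ := hTbP b₂ hb₂
  have hb₁row : b₁.2 = Y' := hTbrow b₁ hb₁
  have hb₂row : b₂.2 = Y' := hTbrow b₂ hb₂
  have hSbot := forall_bottom_ne_S hh hr h hY' (by omega)
  obtain ⟨X', -, hX', -⟩ := exists_right_entry_turn hh hr h
  obtain ⟨X, hXw, hX, -⟩ := exists_left_entry_turn hh hr h hA
  ---------------------------------------------------------------- the first turn and the middle turn `τ = (τ1, w.2)`, `τ1 ≥ w.1`
  have hexk : ∃ k, k < n ∧ arcKind (ω.2.sIn k) (ω.2.sOut k) ≠ .straight := ⟨_, hF, hNS⟩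
  obtain ⟨hk₁, -⟩ := Nat.find_spec hexk
  set k₁ := Nat.find hexk with hk₁def
  have hstr : ∀ i < k₁, arcKind (ω.2.sIn i) (ω.2.sOut i) = .straight := by
    intro i hi; by_contra hne; exact Nat.find_min hexk hi ⟨by omega, hne⟩
  obtain ⟨hrun, -⟩ := ω.2.initial_run hh hk₁ hstr
  obtain ⟨hfk, hWk⟩ := hrun k₁ le_rfl
  have hp₁W : ω.2.UsesSide (w.1 + k₁, w.2) .W := ⟨k₁, hk₁, hfk, Or.inl hWk⟩
  obtain ⟨τ1, hPτ, hτ1w⟩ : ∃ τ1 : ℤ, P (τ1, w.2) ∧ w.1 + k₁ ≤ τ1 := by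
    by_cases hpE : ω.2.UsesSide (w.1 + k₁, w.2) .E
    · obtain ⟨M, hWall, -, hend⟩ := ω.2.chain_E hX' hpE
      rcases hend with ⟨hM1, hnot⟩ | ⟨-, hs0⟩ | ⟨hZ, -⟩
      · obtain ⟨i', hi', hfc', hsv', -, -, -, hk'⟩ := ω.2.isolated_of_usesSide_not_opp (hWall M hM1 le_rfl) hnot
        refine ⟨w.1 + k₁ + M, ?_, by omega⟩
        have := hPiso i' hi' hsv' hk'; rw [hfc'] at this; exact this
      · exact absurd hs0 h0E
      · exfalso; rw [hL] at hZ; have := congrArg Prod.snd hZ; simp only at this; omega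
    · obtain ⟨i', hi', hfc', hsv', -, -, -, hk'⟩ := ω.2.isolated_of_usesSide_not_opp hp₁W hpE
      refine ⟨w.1 + k₁, ?_, le_rfl⟩
      have := hPiso i' hi' hsv' hk'; rw [hfc'] at this; exact this
  ---------------------------------------------------------------- the two other top-row turns: `tA = (r.1 − MA, r.2)` (west chain of `r`), `tB = (r.1 + 1 + MB, r.2)` (at or east of `L`)
  obtain ⟨MA, hEA, -, hendA⟩ := ω.2.chain_W hX hrW
  obtain ⟨hMA1, hPtA⟩ : 1 ≤ MA ∧ P (r.1 - MA, r.2) := by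
    rcases hendA with ⟨hM1, hnot⟩ | ⟨hA0, -⟩ | ⟨hZ, -⟩
    · obtain ⟨i', hi', hfc', hsv', -, -, -, hk'⟩ := ω.2.isolated_of_usesSide_not_opp (hEA MA hM1 le_rfl) hnot
      refine ⟨hM1, ?_⟩
      have := hPiso i' hi' hsv' hk'; rw [hfc'] at this; exact this
    · exfalso; rw [h0w] at hA0; have := congrArg Prod.snd hA0; simp only at this; omega
    · exfalso; rw [hL] at hZ; have := congrArg Prod.fst hZ; simp only at this; omega
  obtain ⟨MB, hPtB⟩ : ∃ MB : ℕ, P (r.1 + 1 + MB, r.2) := by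
    have hsvL : ∀ j < n, ω.2.fc j = ω.2.fc (n - 1) → j = n - 1 :=
      fun j hj e => (top_single_visit hh hr h hY habove hn1 hj (by rw [hL]) e.symm).symm
    obtain ⟨hLN1, hLN2⟩ := hNtop _ hn1 (by rw [hL])
    have hne := ω.2.sIn_ne_sOut hn1
    have key : ω.2.sIn (n - 1) = .S ∨ ω.2.sIn (n - 1) = .E := by
      revert hne hLN1 hLN2; rw [hsW]; cases ω.2.sIn (n - 1) <;> decide
    rcases key with hS | hE
    · refine ⟨0, ?_⟩
      have hk : arcKind (ω.2.sIn (n - 1)) (ω.2.sOut (n - 1)) ≠ .straight := by rw [hS, hsW]; decide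
      have := hPiso _ hn1 hsvL hk
      rw [hL] at this; simpa using this
    · obtain ⟨M, hWall, -, hend⟩ := ω.2.chain_E hX' ⟨_, hn1, hL, Or.inl hE⟩
      rcases hend with ⟨hM1, hnot⟩ | ⟨-, hs0⟩ | ⟨-, hsZ⟩
      · obtain ⟨i', hi', hfc', hsv', -, -, -, hk'⟩ := ω.2.isolated_of_usesSide_not_opp (hWall M hM1 le_rfl) hnot
        refine ⟨M, ?_⟩
        have := hPiso i' hi' hsv' hk'; rw [hfc'] at this; simpa using this
      · exact absurd hs0 h0E
      · rw [hsW] at hsZ; exact absurd hsZ (by decide)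
  ---------------------------------------------------------------- outsiders: any seventh isolated turn is impossible; the middle band carries only `τ`
  have hne_of_row : ∀ f g : Face, f.2 ≠ g.2 → f ≠ g := fun f g hfg e => hfg (by rw [e])
  have houts : ∀ g : Face, P g → g ≠ r → g ≠ (r.1 - (MA : ℤ), r.2) → g ≠ (r.1 + 1 + (MB : ℤ), r.2) → g ≠ b₁ → g ≠ b₂ → g ≠ ((τ1 : ℤ), w.2) → False := by
    intro g hPg n0 n1 n2 n3 n4 n5
    have h01 : r ≠ (r.1 - (MA : ℤ), r.2) := by intro e; have := congrArg Prod.fst e; simp only at this; omega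
    have h02 : r ≠ (r.1 + 1 + (MB : ℤ), r.2) := by intro e; have := congrArg Prod.fst e; simp only at this; omega
    have h03 : r ≠ b₁ := hne_of_row _ _ (by rw [hb₁row]; omega)
    have h04 : r ≠ b₂ := hne_of_row _ _ (by rw [hb₂row]; omega)
    have h05 : r ≠ ((τ1 : ℤ), w.2) := hne_of_row _ _ (by simp only; omega)
    have h12 : ((r.1 : ℤ) - MA, r.2) ≠ (r.1 + 1 + (MB : ℤ), r.2) := by intro e; have := congrArg Prod.fst e; simp only at this; omega
    have h13 : ((r.1 : ℤ) - MA, r.2) ≠ b₁ := hne_of_row _ _ (by rw [hb₁row]; simp only; omega)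
    have h14 : ((r.1 : ℤ) - MA, r.2) ≠ b₂ := hne_of_row _ _ (by rw [hb₂row]; simp only; omega)
    have h15 : ((r.1 : ℤ) - MA, r.2) ≠ ((τ1 : ℤ), w.2) := hne_of_row _ _ (by simp only; omega)
    have h23 : ((r.1 : ℤ) + 1 + MB, r.2) ≠ b₁ := hne_of_row _ _ (by rw [hb₁row]; simp only; omega)
    have h24 : ((r.1 : ℤ) + 1 + MB, r.2) ≠ b₂ := hne_of_row _ _ (by rw [hb₂row]; simp only; omega)
    have h25 : ((r.1 : ℤ) + 1 + MB, r.2) ≠ ((τ1 : ℤ), w.2) := hne_of_row _ _ (by simp only; omega)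
    have h34 : b₁ ≠ b₂ := hb12
    have h35 : b₁ ≠ ((τ1 : ℤ), w.2) := hne_of_row _ _ (by rw [hb₁row]; simp only; omega)
    have h45 : b₂ ≠ ((τ1 : ℤ), w.2) := hne_of_row _ _ (by rw [hb₂row]; simp only; omega)
    have hT : ∀ f ∈ ({g, r, ((r.1 : ℤ) - MA, r.2), ((r.1 : ℤ) + 1 + MB, r.2), b₁, b₂, ((τ1 : ℤ), w.2)} : Finset Face), P f := by
      intro f hf
      simp only [Finset.mem_insert, Finset.mem_singleton] at hf
      rcases hf with rfl | rfl | rfl | rfl | rfl | rfl | rfl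
      exacts [hPg, hPr, hPtA, hPtB, hPb₁, hPb₂, hPτ]
    have hcard : ({g, r, ((r.1 : ℤ) - MA, r.2), ((r.1 : ℤ) + 1 + MB, r.2), b₁, b₂, ((τ1 : ℤ), w.2)} : Finset Face).card = 7 := by
      rw [Finset.card_insert_of_notMem (by simp only [Finset.mem_insert, Finset.mem_singleton, not_or]; exact ⟨n0, n1, n2, n3, n4, n5⟩),
        Finset.card_insert_of_notMem (by simp only [Finset.mem_insert, Finset.mem_singleton, not_or]; exact ⟨h01, h02, h03, h04, h05⟩),
        Finset.card_insert_of_notMem (by simp only [Finset.mem_insert, Finset.mem_singleton, not_or]; exact ⟨h12, h13, h14, h15⟩),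
        Finset.card_insert_of_notMem (by simp only [Finset.mem_insert, Finset.mem_singleton, not_or]; exact ⟨h23, h24, h25⟩),
        Finset.card_insert_of_notMem (by simp only [Finset.mem_insert, Finset.mem_singleton, not_or]; exact ⟨h34, h35⟩),
        Finset.card_insert_of_notMem (by simp only [Finset.mem_singleton]; exact h45), Finset.card_singleton]
    have := hle6 _ hT
    omega
  have hPmid : ∀ f, P f → Y' < f.2 → f.2 < r.2 → w.1 ≤ f.1 := by
    intro f hf h1 h2
    by_cases hfτ : f = ((τ1 : ℤ), w.2)
    · rw [hfτ]; simp only; omega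
    · exfalso
      exact houts f hf (hne_of_row _ _ (by omega)) (hne_of_row _ _ (by simp only; omega)) (hne_of_row _ _ (by simp only; omega))
        (hne_of_row _ _ (by rw [hb₁row]; omega)) (hne_of_row _ _ (by rw [hb₂row]; omega)) hfτ
  ---------------------------------------------------------------- ★ no plaquette strictly between the extreme rows and west of the root column uses `W`
  have hWmid : ∀ c : Face, Y' < c.2 → c.2 < r.2 → c.1 < w.1 → ¬ω.2.UsesSide c .W := by
    intro c h1 h2 h3 hcW
    obtain ⟨M, hEall, -, hend⟩ := ω.2.chain_W hX hcW
    rcases hend with ⟨hM1, hnot⟩ | ⟨hA0, -⟩ | ⟨hZ, -⟩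
    · obtain ⟨i', hi', hfc', hsv', -, -, -, hk'⟩ := ω.2.isolated_of_usesSide_not_opp (hEall M hM1 le_rfl) hnot
      have hP' : P (c.1 - M, c.2) := by rw [← hfc']; exact hPiso i' hi' hsv' hk'
      have := hPmid _ hP' h1 h2
      simp only at this; omega
    · rw [h0w] at hA0; have := congrArg Prod.fst hA0; simp only at this; omega
    · rw [hL] at hZ; have := congrArg Prod.snd hZ; simp only at this; omega
  have hsvmid : ∀ i < n, Y' < (ω.2.fc i).2 → (ω.2.fc i).2 < r.2 → (ω.2.fc i).1 < w.1 → ∀ j < n, ω.2.fc j = ω.2.fc i → j = i := by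
    intro i hi h1 h2 h3 j hj he
    by_contra hne
    exact hWmid _ h1 h2 h3 (ω.2.usesSide_of_fc_eq hi hj (Ne.symm hne) he.symm .W)
  ---------------------------------------------------------------- the south chain of `r`: the WALL — a straight singly visited column down to a bottom turn `b = (r.1, Y')`
  obtain ⟨Mc, hNc, hSc, hendc⟩ := ω.2.chain_S hY' hrS
  obtain ⟨hMc, hBN, hBnS⟩ : (Mc : ℤ) = r.2 - Y' ∧ ω.2.UsesSide (r.1, Y') .N ∧ ¬ω.2.UsesSide (r.1, Y') .S := by
    rcases hendc with ⟨hM1, hnot⟩ | ⟨-, hs0⟩ | ⟨-, hsZ⟩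
    · obtain ⟨i', hi', hfc', hsv', -, -, -, hk'⟩ := ω.2.isolated_of_usesSide_not_opp (hNc Mc hM1 le_rfl) hnot
      have hP' : P (r.1, r.2 - Mc) := by rw [← hfc']; exact hPiso i' hi' hsv' hk'
      have hge : Y' ≤ r.2 - Mc := by have := hY' i' hi'; rw [hfc'] at this; exact this
      rcases lt_or_eq_of_le hge with hlt | heq
      · have := hPmid _ hP' hlt (by simp only; omega)
        simp only at this; omega
      · have eY : r.2 - (Mc : ℤ) = Y' := heq.symm
        refine ⟨by omega, ?_, ?_⟩
        · have := hNc Mc hM1 le_rfl; rwa [eY] at this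
        · rwa [eY] at hnot
    · exact absurd hs0 h0S
    · rw [hsW] at hsZ; exact absurd hsZ (by decide)
  obtain ⟨iB, hiB, hfcB, hsvB, -, -, -, -⟩ := ω.2.isolated_of_usesSide_not_opp hBN hBnS
  have hMc1 : 1 ≤ Mc := by omega
  -- the cells strictly inside the wall are straight and vertical
  have hwall_straight : ∀ m : ℕ, 1 ≤ m → m < Mc → ∀ i < n, ω.2.fc i = (r.1, r.2 - m) →
      (∀ j < n, ω.2.fc j = ω.2.fc i → j = i) ∧ arcKind (ω.2.sIn i) (ω.2.sOut i) = .straight ∧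
        (ω.2.sIn i = .S ∨ ω.2.sIn i = .N) := by
    intro m hm1 hmM i hi hfi
    have hsv := hsvmid i hi (by rw [hfi]; simp only; omega) (by rw [hfi]; simp only; omega) (by rw [hfi]; exact hwest)
    have hN := hNc m hm1 hmM.le
    have hS := hSc m hmM
    obtain ⟨j, hj, hfj, hjN⟩ := hN
    obtain ⟨k, hk, hfk', hkS⟩ := hS
    rw [hsv j hj (hfj.trans hfi.symm)] at hjN
    rw [hsv k hk (hfk'.trans hfi.symm)] at hkS
    have hne := ω.2.sIn_ne_sOut hi
    refine ⟨hsv, ?_⟩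
    revert hjN hkS hne
    cases ω.2.sIn i <;> cases ω.2.sOut i <;> decide
  -- every plaquette of column `r.1` is a wall cell: `r`, an inner cell `(r.1, r.2 − m)` (`1 ≤ m < Mc`), or `b = (r.1, Y')`
  have hwall_cases : ∀ i < n, (ω.2.fc i).1 = r.1 →
      i = ω.2.firstHitG ∨ (∃ m : ℕ, 1 ≤ m ∧ m < Mc ∧ ω.2.fc i = (r.1, r.2 - m)) ∨ i = iB := by
    intro i hi hci
    have h1 := hY i hi; have h2 := hY' i hi
    rcases lt_trichotomy (ω.2.fc i).2 Y' with hlt | heq | hgt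
    · omega
    · right; right
      have e : ω.2.fc i = (r.1, Y') := Prod.ext hci heq
      exact hsvB i hi (e.trans hfcB.symm)
    · rcases lt_or_eq_of_le h1 with hlt' | heq'
      · right; left
        refine ⟨(r.2 - (ω.2.fc i).2).toNat, by omega, by omega, Prod.ext hci (by simp only; omega)⟩
      · left; exact hsvr i hi (by rw [hfcF]; exact Prod.ext hci heq')
  ---------------------------------------------------------------- the two orientations of the arc of `r`
  rcases hrarc with ⟨hinS, houtW⟩ | ⟨hinW, houtS⟩
  · ---------------------------------------------------------------- (A) `r` entered from below: the prefix climbed the wall; the excursion cannot cross it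
    -- the wall was climbed: `fc (fh − m) = (r.1, r.2 − m)` for `m ≤ Mc − 1`, then `b` at `fh − Mc`
    have hfhMc : Mc - 1 ≤ ω.2.firstHitG := by
      by_contra hlt
      push Not at hlt
      have hrb := ω.2.run_back_below_of_straight hF le_rfl hinS
        (fun m hm1 hmM i hi hfi => (hwall_straight m hm1 (by omega) i hi (by rw [hfi, hfcF])).2.1) ω.2.firstHitG le_rfl
      rw [Nat.sub_self, h0w, hfcF] at hrb
      have := congrArg Prod.fst hrb.1; simp only at this; omega
    have hrb := ω.2.run_back_below_of_straight hF hfhMc hinS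
      (fun m hm1 hmM i hi hfi => (hwall_straight m hm1 (by omega) i hi (by rw [hfi, hfcF])).2.1)
    -- indices of wall cells are `≤ firstHitG`
    have hwall_le : ∀ i < n, (ω.2.fc i).1 = r.1 → i ≤ ω.2.firstHitG := by
      intro i hi hci
      rcases hwall_cases i hi hci with e | ⟨m, hm1, hmM, hfi⟩ | e
      · omega
      · obtain ⟨hfm, -⟩ := hrb m (by omega)
        rw [hfcF] at hfm
        have := (hwall_straight m hm1 hmM i hi hfi).1 (ω.2.firstHitG - m) (by omega) (by rw [hfm, hfi])
        omega
      · -- `b`: the predecessor of the lowest climbed cell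
        obtain ⟨hfm, hsm⟩ := hrb (Mc - 1) le_rfl
        rw [hfcF] at hfm
        have h1 : 1 ≤ ω.2.firstHitG - (Mc - 1) := by
          by_contra h0; push Not at h0
          have e0 : ω.2.firstHitG - (Mc - 1) = 0 := by omega
          rw [e0] at hsm; rw [hsm] at h0W; exact absurd h0W (by decide)
        have hp := ω.2.fc_pred_eq_of_sIn_S (show ω.2.firstHitG - (Mc - 1) < n by omega) h1 hsm
        rw [hfm] at hp
        have hpb : ω.2.fc (ω.2.firstHitG - (Mc - 1) - 1) = (r.1, Y') := by rw [hp]; exact Prod.ext rfl (by simp only; omega)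
        have := hsvB _ (by omega) (hpb.trans hfcB.symm)
        omega
    -- the excursion starts west of the wall and ends east of it: it crosses the wall
    have hF1 : ω.2.firstHitG + 1 < n := by omega
    obtain ⟨hfc1, -⟩ := ω.2.fc_succ_eq_of_sOut_W hF1 houtW
    obtain ⟨k, hk1, hk2, hkc⟩ := ω.2.exists_fst_eq_between (i := ω.2.firstHitG + 1) (j := n - 1) (by omega) hn1 (x := r.1)
      (by rw [hfc1, hfcF]; simp only; omega) (by rw [hL]; simp only; omega)
    have := hwall_le k (by omega) hkc
    omega
  · ---------------------------------------------------------------- (B) `r` left downwards: the excursion descends the wall; the prefix from `w` (east) reached `r` from the west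
    have hfhMc : ω.2.firstHitG + (Mc - 1) < n := by
      by_contra hge
      push Not at hge
      have hrd := ω.2.run_down_of_straight (j := ω.2.firstHitG) (M := n - 1 - ω.2.firstHitG) (by omega) houtS
        (fun m hm1 hmM i hi hfi => (hwall_straight m hm1 (by omega) i hi (by rw [hfi, hfcF])).2.1) (n - 1 - ω.2.firstHitG) le_rfl
      rw [show ω.2.firstHitG + (n - 1 - ω.2.firstHitG) = n - 1 by omega, hL, hfcF] at hrd
      have := congrArg Prod.fst hrd.1; simp only at this; omega
    have hrd := ω.2.run_down_of_straight (j := ω.2.firstHitG) (M := Mc - 1) hfhMc houtS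
      (fun m hm1 hmM i hi hfi => (hwall_straight m hm1 (by omega) i hi (by rw [hfi, hfcF])).2.1)
    -- indices of wall cells are `≥ firstHitG`
    have hwall_ge : ∀ i < n, (ω.2.fc i).1 = r.1 → ω.2.firstHitG ≤ i := by
      intro i hi hci
      rcases hwall_cases i hi hci with e | ⟨m, hm1, hmM, hfi⟩ | e
      · omega
      · obtain ⟨hfm, -⟩ := hrd m (by omega)
        rw [hfcF] at hfm
        have := (hwall_straight m hm1 hmM i hi hfi).1 (ω.2.firstHitG + m) (by omega) (by rw [hfm, hfi])
        omega
      · obtain ⟨hfm, hsm⟩ := hrd (Mc - 1) le_rfl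
        rw [hfcF] at hfm
        have h1 : ω.2.firstHitG + (Mc - 1) + 1 < n := by
          by_contra h0
          have e0 : ω.2.firstHitG + (Mc - 1) = n - 1 := by omega
          rw [e0, hL] at hfm; have := congrArg Prod.fst hfm; simp only at this; omega
        have hs := ω.2.fc_succ_eq_of_sOut_S h1 hsm
        rw [hfm] at hs
        have hsb : ω.2.fc (ω.2.firstHitG + (Mc - 1) + 1) = (r.1, Y') := by rw [hs]; exact Prod.ext rfl (by simp only; omega)
        have := hsvB _ h1 (hsb.trans hfcB.symm)
        omega
    -- the prefix: from `w` (east of the wall) to `(r.1 − 1, r.2)` just before `r`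
    have hF1 : 1 ≤ ω.2.firstHitG := by
      by_contra h0; push Not at h0
      have e0 : ω.2.firstHitG = 0 := by omega
      rw [e0] at hinW hfcF
      rw [h0w] at hfcF
      have := congrArg Prod.fst hfcF; omega
    have hp := (ω.2.fc_pred_eq_of_sIn_W hF hF1 hinW).1
    rw [hfcF] at hp
    obtain ⟨k, -, hk2, hkc⟩ := ω.2.exists_fst_eq_between' (i := 0) (j := ω.2.firstHitG - 1) (by omega) (by omega) (x := r.1)
      (by rw [h0w]; omega) (by rw [hp]; simp only; omega)
    have := hwall_ge k (by omega) hkc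
    omega

/-- The case `ω.1 = W` of `rootCol_le_of_cost_seven_vert_above` (the wall argument). [cite: GlazmanManolescu2019, §1, Fig. 1 and eq. (1); Lemma 2.1; Remark 2.2]
[cite: Glazman2015WeightedSAW, Lemma 3.1 (proof, pp. 6–7)] [cite: CourantRobbins1958, Ch. V Appendix §2 (the even–odd rule)] -/
private theorem not_west_of_cost_seven_W_above (hh : holeFaceW w ∉ D) (hr : RootedFace D (w.side .W) r) (h : ω.IsB2a)
    (hA : ω.AJ hr h (toC (midPt (w.side .W))) ≠ 0) (hc : cost (slotOfSide ω.1) ω.2.mids = 7) (hωW : ω.1 = .W)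
    (hNS : arcKind (ω.2.sIn ω.2.firstHitG) (ω.2.sOut ω.2.firstHitG) ≠ .straight) (habove : w.2 < r.2) (hwest : r.1 < w.1) : False := by
  classical
  set n := ω.2.arcs.length with hn
  have hz : ω.1 = .E ∨ ω.1 = .W := Or.inr hωW
  ---------------------------------------------------------------- basics
  have hF := ω.fh_lt h
  have hlen : 0 < n := by omega
  have h0w : ω.2.fc 0 = w := fc_zero_eq_root w hh ω.2 hlen
  have h0W : ω.2.sIn 0 = .W := YBWalk.sIn_zero_eq_W hh ω.2 hlen
  have h0E : ω.2.sIn 0 ≠ .E := by rw [h0W]; decide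
  have h0S : ω.2.sIn 0 ≠ .S := by rw [h0W]; decide
  have hfcF := (fc_fh ω hr h).1
  have hsvr : ∀ l < n, ω.2.fc l = ω.2.fc ω.2.firstHitG → l = ω.2.firstHitG := fun l hl e => eq_firstHitG_of_fc_eq hr h hl e
  have hfne3 : ω.2.firstHitG + 3 ≤ n := by have := three_le_Mv hr h; have := fh_add_Mv h; unfold ΩG.Mv at *; omega
  have hn1 : n - 1 < n := by omega
  -- the top row is the row of `r`; `r` uses `S`, not `N`
  have hY : ∀ j < n, (ω.2.fc j).2 ≤ r.2 := top_row_of_cost_seven_vert_above hh hr h hA hc hz hNS habove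
  obtain ⟨hrS', hnN1, hnN2⟩ := usesSide_S_of_cost_seven_vert_above hh hr h hA hc hz hNS habove
  have hrS : ω.2.UsesSide r .S := ⟨_, hF, hfcF, hrS'⟩
  have hNtop := forall_top_ne_N hh hr h hY habove
  -- the last plaquette `L = (r.1 − 1, r.2)`, left through `E`
  obtain ⟨hsE, hL⟩ : ω.2.sOut (n - 1) = .E ∧ ω.2.fc (n - 1) = (r.1 - 1, r.2) := by
    rcases last_of_vertical_end hr h (Or.inr hωW) with ⟨h1, -, -⟩ | ⟨-, h2, h3⟩
    · rw [hωW] at h1; exact absurd h1 (by decide)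
    · exact ⟨h2, h3⟩
  -- the side of `r` carrying the end is not used by the arc of `r`: the arc of `r` is `{S, E}`
  have hrside : ∀ s, ω.2.UsesSide r s → r.side s ≠ r.side ω.1 := by
    rintro s ⟨l, hl, hfl, hs⟩ e
    have hl' := hsvr l hl (hfl.trans hfcF.symm)
    obtain ⟨hin, hout⟩ := ω.2.side_sIn_eq_nth hl
    rw [hfl] at hin hout
    rw [← ω.2.nth_length] at e
    rcases hs with hs | hs
    · rw [hs] at hin; have := ω.2.nth_inj (show l ≤ n by omega) le_rfl (hin.symm.trans e).symm.symm; omega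
    · rw [hs] at hout; have := ω.2.nth_inj (show l + 1 ≤ n by omega) le_rfl (hout.symm.trans e).symm.symm; omega
  have hrarc : (ω.2.sIn ω.2.firstHitG = .S ∧ ω.2.sOut ω.2.firstHitG = .E) ∨ (ω.2.sIn ω.2.firstHitG = .E ∧ ω.2.sOut ω.2.firstHitG = .S) := by
    have hne := ω.2.sIn_ne_sOut hF
    have hnoW : ¬(ω.2.sIn ω.2.firstHitG = .W ∨ ω.2.sOut ω.2.firstHitG = .W) := fun hs => hrside .W ⟨_, hF, hfcF, hs⟩ (by rw [hωW])
    revert hne hnoW hrS' hnN1 hnN2; cases ω.2.sIn ω.2.firstHitG <;> cases ω.2.sOut ω.2.firstHitG <;> decide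
  have hrE : ω.2.UsesSide r .E := by
    rcases hrarc with ⟨-, e⟩ | ⟨e, -⟩
    · exact ⟨_, hF, hfcF, Or.inr e⟩
    · exact ⟨_, hF, hfcF, Or.inl e⟩
  ---------------------------------------------------------------- isolated turns: six, as `P`-cells
  have h6 : cfgCount ω.2.mids [.corner] + cfgCount ω.2.mids [.coCorner] = 6 := by
    have hcost : cost (slotOfSide ω.1) ω.2.mids =
        cfgCount ω.2.mids [.corner] + cfgCount ω.2.mids [.coCorner] + (1 - slotDeg (slotOfSide ω.1)) := rfl
    have hd : slotDeg (slotOfSide ω.1) = 0 := by rw [hωW]; rfl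
    rw [hcost, hd] at hc; omega
  let P : Face → Prop := fun f => f ∈ facesL ω.2.mids ∧ (kindsL ω.2.mids f = [.corner] ∨ kindsL ω.2.mids f = [.coCorner])
  have hPiso : ∀ k < n, (∀ l < n, ω.2.fc l = ω.2.fc k → l = k) → arcKind (ω.2.sIn k) (ω.2.sOut k) ≠ .straight → P (ω.2.fc k) :=
    fun k hk hsv hkind => isolated_turn hk hsv hkind
  have hle6 : ∀ T : Finset Face, (∀ f ∈ T, P f) → T.card ≤ 6 := by
    intro T hT; have := YBWalk.card_le_cfgCount_add ω.2.mids T hT; omega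
  have hPr : P r := by have := hPiso _ hF hsvr hNS; rwa [hfcF] at this
  -- two bottom-row turns `b₁ ≠ b₂`
  obtain ⟨Y', hY'w, hY', Tb, hTbP, hTbrow, hTbcard⟩ := two_bottom_turns hh hr h hA
  have hTb2 : 1 < Tb.card := by
    rcases hTbcard with h2 | ⟨-, -, hrY⟩
    · omega
    · exfalso; omega
  obtain ⟨b₁, hb₁, b₂, hb₂, hb12⟩ := Finset.one_lt_card.1 hTb2
  have hPb₁ : P b₁ := hTbP b₁ hb₁
  have hPb₂ : P b₂ := hTbP b₂ hb₂
  have hb₁row : b₁.2 = Y' := hTbrow b₁ hb₁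
  have hb₂row : b₂.2 = Y' := hTbrow b₂ hb₂
  have hSbot := forall_bottom_ne_S hh hr h hY' (by omega)
  obtain ⟨X', -, hX', -⟩ := exists_right_entry_turn hh hr h
  obtain ⟨X, hXw, hX, -⟩ := exists_left_entry_turn hh hr h hA
  ---------------------------------------------------------------- the first turn and the middle turn `τ = (τ1, w.2)`, `τ1 ≥ w.1`
  have hexk : ∃ k, k < n ∧ arcKind (ω.2.sIn k) (ω.2.sOut k) ≠ .straight := ⟨_, hF, hNS⟩
  obtain ⟨hk₁, -⟩ := Nat.find_spec hexk
  set k₁ := Nat.find hexk with hk₁def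
  have hstr : ∀ i < k₁, arcKind (ω.2.sIn i) (ω.2.sOut i) = .straight := by
    intro i hi; by_contra hne; exact Nat.find_min hexk hi ⟨by omega, hne⟩
  obtain ⟨hrun, -⟩ := ω.2.initial_run hh hk₁ hstr
  obtain ⟨hfk, hWk⟩ := hrun k₁ le_rfl
  have hp₁W : ω.2.UsesSide (w.1 + k₁, w.2) .W := ⟨k₁, hk₁, hfk, Or.inl hWk⟩
  obtain ⟨τ1, hPτ, hτ1w⟩ : ∃ τ1 : ℤ, P (τ1, w.2) ∧ w.1 + k₁ ≤ τ1 := by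
    by_cases hpE : ω.2.UsesSide (w.1 + k₁, w.2) .E
    · obtain ⟨M, hWall, -, hend⟩ := ω.2.chain_E hX' hpE
      rcases hend with ⟨hM1, hnot⟩ | ⟨-, hs0⟩ | ⟨hZ, -⟩
      · obtain ⟨i', hi', hfc', hsv', -, -, -, hk'⟩ := ω.2.isolated_of_usesSide_not_opp (hWall M hM1 le_rfl) hnot
        refine ⟨w.1 + k₁ + M, ?_, by omega⟩
        have := hPiso i' hi' hsv' hk'; rw [hfc'] at this; exact this
      · exact absurd hs0 h0E
      · exfalso; rw [hL] at hZ; have := congrArg Prod.snd hZ; simp only at this; omega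
    · obtain ⟨i', hi', hfc', hsv', -, -, -, hk'⟩ := ω.2.isolated_of_usesSide_not_opp hp₁W hpE
      refine ⟨w.1 + k₁, ?_, le_rfl⟩
      have := hPiso i' hi' hsv' hk'; rw [hfc'] at this; exact this
  ---------------------------------------------------------------- the two other top-row turns: `tA = (r.1 + MA, r.2)` (east chain of `r`), `tB = (r.1 − 1 − MB, r.2)` (at or west of `L`)
  obtain ⟨MA, hWA, -, hendA⟩ := ω.2.chain_E hX' hrE
  obtain ⟨hMA1, hPtA⟩ : 1 ≤ MA ∧ P (r.1 + MA, r.2) := by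
    rcases hendA with ⟨hM1, hnot⟩ | ⟨-, hs0⟩ | ⟨hZ, -⟩
    · obtain ⟨i', hi', hfc', hsv', -, -, -, hk'⟩ := ω.2.isolated_of_usesSide_not_opp (hWA MA hM1 le_rfl) hnot
      refine ⟨hM1, ?_⟩
      have := hPiso i' hi' hsv' hk'; rw [hfc'] at this; exact this
    · exact absurd hs0 h0E
    · exfalso; rw [hL] at hZ; have := congrArg Prod.fst hZ; simp only at this; omega
  obtain ⟨MB, hPtB⟩ : ∃ MB : ℕ, P (r.1 - 1 - MB, r.2) := by
    have hsvL : ∀ j < n, ω.2.fc j = ω.2.fc (n - 1) → j = n - 1 :=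
      fun j hj e => (top_single_visit hh hr h hY habove hn1 hj (by rw [hL]) e.symm).symm
    obtain ⟨hLN1, hLN2⟩ := hNtop _ hn1 (by rw [hL])
    have hne := ω.2.sIn_ne_sOut hn1
    have key : ω.2.sIn (n - 1) = .S ∨ ω.2.sIn (n - 1) = .W := by
      revert hne hLN1 hLN2; rw [hsE]; cases ω.2.sIn (n - 1) <;> decide
    rcases key with hS | hW
    · refine ⟨0, ?_⟩
      have hk : arcKind (ω.2.sIn (n - 1)) (ω.2.sOut (n - 1)) ≠ .straight := by rw [hS, hsE]; decide
      have := hPiso _ hn1 hsvL hk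
      rw [hL] at this; simpa using this
    · obtain ⟨M, hEall, -, hend⟩ := ω.2.chain_W hX ⟨_, hn1, hL, Or.inl hW⟩
      rcases hend with ⟨hM1, hnot⟩ | ⟨hA0, -⟩ | ⟨-, hsZ⟩
      · obtain ⟨i', hi', hfc', hsv', -, -, -, hk'⟩ := ω.2.isolated_of_usesSide_not_opp (hEall M hM1 le_rfl) hnot
        refine ⟨M, ?_⟩
        have := hPiso i' hi' hsv' hk'; rw [hfc'] at this; simpa using this
      · exfalso; rw [h0w] at hA0; have := congrArg Prod.snd hA0; simp only at this; omega
      · rw [hsE] at hsZ; exact absurd hsZ (by decide)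
  ---------------------------------------------------------------- outsiders: any seventh isolated turn is impossible; the middle band carries only `τ`
  have hne_of_row : ∀ f g : Face, f.2 ≠ g.2 → f ≠ g := fun f g hfg e => hfg (by rw [e])
  have houts : ∀ g : Face, P g → g ≠ r → g ≠ (r.1 + (MA : ℤ), r.2) → g ≠ (r.1 - 1 - (MB : ℤ), r.2) → g ≠ b₁ → g ≠ b₂ → g ≠ ((τ1 : ℤ), w.2) → False := by
    intro g hPg n0 n1 n2 n3 n4 n5
    have h01 : r ≠ (r.1 + (MA : ℤ), r.2) := by intro e; have := congrArg Prod.fst e; simp only at this; omega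
    have h02 : r ≠ (r.1 - 1 - (MB : ℤ), r.2) := by intro e; have := congrArg Prod.fst e; simp only at this; omega
    have h03 : r ≠ b₁ := hne_of_row _ _ (by rw [hb₁row]; omega)
    have h04 : r ≠ b₂ := hne_of_row _ _ (by rw [hb₂row]; omega)
    have h05 : r ≠ ((τ1 : ℤ), w.2) := hne_of_row _ _ (by simp only; omega)
    have h12 : ((r.1 : ℤ) + MA, r.2) ≠ (r.1 - 1 - (MB : ℤ), r.2) := by intro e; have := congrArg Prod.fst e; simp only at this; omega
    have h13 : ((r.1 : ℤ) + MA, r.2) ≠ b₁ := hne_of_row _ _ (by rw [hb₁row]; simp only; omega)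
    have h14 : ((r.1 : ℤ) + MA, r.2) ≠ b₂ := hne_of_row _ _ (by rw [hb₂row]; simp only; omega)
    have h15 : ((r.1 : ℤ) + MA, r.2) ≠ ((τ1 : ℤ), w.2) := hne_of_row _ _ (by simp only; omega)
    have h23 : ((r.1 : ℤ) - 1 - MB, r.2) ≠ b₁ := hne_of_row _ _ (by rw [hb₁row]; simp only; omega)
    have h24 : ((r.1 : ℤ) - 1 - MB, r.2) ≠ b₂ := hne_of_row _ _ (by rw [hb₂row]; simp only; omega)
    have h25 : ((r.1 : ℤ) - 1 - MB, r.2) ≠ ((τ1 : ℤ), w.2) := hne_of_row _ _ (by simp only; omega)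
    have h34 : b₁ ≠ b₂ := hb12
    have h35 : b₁ ≠ ((τ1 : ℤ), w.2) := hne_of_row _ _ (by rw [hb₁row]; simp only; omega)
    have h45 : b₂ ≠ ((τ1 : ℤ), w.2) := hne_of_row _ _ (by rw [hb₂row]; simp only; omega)
    have hT : ∀ f ∈ ({g, r, ((r.1 : ℤ) + MA, r.2), ((r.1 : ℤ) - 1 - MB, r.2), b₁, b₂, ((τ1 : ℤ), w.2)} : Finset Face), P f := by
      intro f hf
      simp only [Finset.mem_insert, Finset.mem_singleton] at hf
      rcases hf with rfl | rfl | rfl | rfl | rfl | rfl | rfl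
      exacts [hPg, hPr, hPtA, hPtB, hPb₁, hPb₂, hPτ]
    have hcard : ({g, r, ((r.1 : ℤ) + MA, r.2), ((r.1 : ℤ) - 1 - MB, r.2), b₁, b₂, ((τ1 : ℤ), w.2)} : Finset Face).card = 7 := by
      rw [Finset.card_insert_of_notMem (by simp only [Finset.mem_insert, Finset.mem_singleton, not_or]; exact ⟨n0, n1, n2, n3, n4, n5⟩),
        Finset.card_insert_of_notMem (by simp only [Finset.mem_insert, Finset.mem_singleton, not_or]; exact ⟨h01, h02, h03, h04, h05⟩),
        Finset.card_insert_of_notMem (by simp only [Finset.mem_insert, Finset.mem_singleton, not_or]; exact ⟨h12, h13, h14, h15⟩),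
        Finset.card_insert_of_notMem (by simp only [Finset.mem_insert, Finset.mem_singleton, not_or]; exact ⟨h23, h24, h25⟩),
        Finset.card_insert_of_notMem (by simp only [Finset.mem_insert, Finset.mem_singleton, not_or]; exact ⟨h34, h35⟩),
        Finset.card_insert_of_notMem (by simp only [Finset.mem_singleton]; exact h45), Finset.card_singleton]
    have := hle6 _ hT
    omega
  have hPmid : ∀ f, P f → Y' < f.2 → f.2 < r.2 → w.1 ≤ f.1 := by
    intro f hf h1 h2
    by_cases hfτ : f = ((τ1 : ℤ), w.2)
    · rw [hfτ]; simp only; omega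
    · exfalso
      exact houts f hf (hne_of_row _ _ (by omega)) (hne_of_row _ _ (by simp only; omega)) (hne_of_row _ _ (by simp only; omega))
        (hne_of_row _ _ (by rw [hb₁row]; omega)) (hne_of_row _ _ (by rw [hb₂row]; omega)) hfτ
  ---------------------------------------------------------------- ★ no plaquette strictly between the extreme rows and west of the root column uses `W`
  have hWmid : ∀ c : Face, Y' < c.2 → c.2 < r.2 → c.1 < w.1 → ¬ω.2.UsesSide c .W := by
    intro c h1 h2 h3 hcW
    obtain ⟨M, hEall, -, hend⟩ := ω.2.chain_W hX hcW
    rcases hend with ⟨hM1, hnot⟩ | ⟨hA0, -⟩ | ⟨hZ, -⟩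
    · obtain ⟨i', hi', hfc', hsv', -, -, -, hk'⟩ := ω.2.isolated_of_usesSide_not_opp (hEall M hM1 le_rfl) hnot
      have hP' : P (c.1 - M, c.2) := by rw [← hfc']; exact hPiso i' hi' hsv' hk'
      have := hPmid _ hP' h1 h2
      simp only at this; omega
    · rw [h0w] at hA0; have := congrArg Prod.fst hA0; simp only at this; omega
    · rw [hL] at hZ; have := congrArg Prod.snd hZ; simp only at this; omega
  have hsvmid : ∀ i < n, Y' < (ω.2.fc i).2 → (ω.2.fc i).2 < r.2 → (ω.2.fc i).1 < w.1 → ∀ j < n, ω.2.fc j = ω.2.fc i → j = i := by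
    intro i hi h1 h2 h3 j hj he
    by_contra hne
    exact hWmid _ h1 h2 h3 (ω.2.usesSide_of_fc_eq hi hj (Ne.symm hne) he.symm .W)
  ---------------------------------------------------------------- the south chain of `r`: the WALL — a straight singly visited column down to a bottom turn `b = (r.1, Y')`
  obtain ⟨Mc, hNc, hSc, hendc⟩ := ω.2.chain_S hY' hrS
  obtain ⟨hMc, hBN, hBnS⟩ : (Mc : ℤ) = r.2 - Y' ∧ ω.2.UsesSide (r.1, Y') .N ∧ ¬ω.2.UsesSide (r.1, Y') .S := by
    rcases hendc with ⟨hM1, hnot⟩ | ⟨-, hs0⟩ | ⟨-, hsZ⟩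
    · obtain ⟨i', hi', hfc', hsv', -, -, -, hk'⟩ := ω.2.isolated_of_usesSide_not_opp (hNc Mc hM1 le_rfl) hnot
      have hP' : P (r.1, r.2 - Mc) := by rw [← hfc']; exact hPiso i' hi' hsv' hk'
      have hge : Y' ≤ r.2 - Mc := by have := hY' i' hi'; rw [hfc'] at this; exact this
      rcases lt_or_eq_of_le hge with hlt | heq
      · have := hPmid _ hP' hlt (by simp only; omega)
        simp only at this; omega
      · have eY : r.2 - (Mc : ℤ) = Y' := heq.symm
        refine ⟨by omega, ?_, ?_⟩
        · have := hNc Mc hM1 le_rfl; rwa [eY] at this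
        · rwa [eY] at hnot
    · exact absurd hs0 h0S
    · rw [hsE] at hsZ; exact absurd hsZ (by decide)
  obtain ⟨iB, hiB, hfcB, hsvB, -, -, -, -⟩ := ω.2.isolated_of_usesSide_not_opp hBN hBnS
  have hMc1 : 1 ≤ Mc := by omega
  -- the cells strictly inside the wall are straight and vertical
  have hwall_straight : ∀ m : ℕ, 1 ≤ m → m < Mc → ∀ i < n, ω.2.fc i = (r.1, r.2 - m) →
      (∀ j < n, ω.2.fc j = ω.2.fc i → j = i) ∧ arcKind (ω.2.sIn i) (ω.2.sOut i) = .straight ∧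
        (ω.2.sIn i = .S ∨ ω.2.sIn i = .N) := by
    intro m hm1 hmM i hi hfi
    have hsv := hsvmid i hi (by rw [hfi]; simp only; omega) (by rw [hfi]; simp only; omega) (by rw [hfi]; exact hwest)
    have hN := hNc m hm1 hmM.le
    have hS := hSc m hmM
    obtain ⟨j, hj, hfj, hjN⟩ := hN
    obtain ⟨k, hk, hfk', hkS⟩ := hS
    rw [hsv j hj (hfj.trans hfi.symm)] at hjN
    rw [hsv k hk (hfk'.trans hfi.symm)] at hkS
    have hne := ω.2.sIn_ne_sOut hi
    refine ⟨hsv, ?_⟩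
    revert hjN hkS hne
    cases ω.2.sIn i <;> cases ω.2.sOut i <;> decide
  -- every plaquette of column `r.1` is a wall cell: `r`, an inner cell `(r.1, r.2 − m)` (`1 ≤ m < Mc`), or `b = (r.1, Y')`
  have hwall_cases : ∀ i < n, (ω.2.fc i).1 = r.1 →
      i = ω.2.firstHitG ∨ (∃ m : ℕ, 1 ≤ m ∧ m < Mc ∧ ω.2.fc i = (r.1, r.2 - m)) ∨ i = iB := by
    intro i hi hci
    have h1 := hY i hi; have h2 := hY' i hi
    rcases lt_trichotomy (ω.2.fc i).2 Y' with hlt | heq | hgt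
    · omega
    · right; right
      have e : ω.2.fc i = (r.1, Y') := Prod.ext hci heq
      exact hsvB i hi (e.trans hfcB.symm)
    · rcases lt_or_eq_of_le h1 with hlt' | heq'
      · right; left
        refine ⟨(r.2 - (ω.2.fc i).2).toNat, by omega, by omega, Prod.ext hci (by simp only; omega)⟩
      · left; exact hsvr i hi (by rw [hfcF]; exact Prod.ext hci heq')
  ---------------------------------------------------------------- the two orientations of the arc of `r`
  rcases hrarc with ⟨hinS, houtE⟩ | ⟨hinE, houtS⟩
  · ---------------------------------------------------------------- (A) `r` entered from below: the prefix climbed the wall; the excursion cannot cross it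
    have hfhMc : Mc - 1 ≤ ω.2.firstHitG := by
      by_contra hlt
      push Not at hlt
      have hrb := ω.2.run_back_below_of_straight hF le_rfl hinS
        (fun m hm1 hmM i hi hfi => (hwall_straight m hm1 (by omega) i hi (by rw [hfi, hfcF])).2.1) ω.2.firstHitG le_rfl
      rw [Nat.sub_self, h0w, hfcF] at hrb
      have := congrArg Prod.fst hrb.1; simp only at this; omega
    have hrb := ω.2.run_back_below_of_straight hF hfhMc hinS
      (fun m hm1 hmM i hi hfi => (hwall_straight m hm1 (by omega) i hi (by rw [hfi, hfcF])).2.1)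
    have hwall_le : ∀ i < n, (ω.2.fc i).1 = r.1 → i ≤ ω.2.firstHitG := by
      intro i hi hci
      rcases hwall_cases i hi hci with e | ⟨m, hm1, hmM, hfi⟩ | e
      · omega
      · obtain ⟨hfm, -⟩ := hrb m (by omega)
        rw [hfcF] at hfm
        have := (hwall_straight m hm1 hmM i hi hfi).1 (ω.2.firstHitG - m) (by omega) (by rw [hfm, hfi])
        omega
      · obtain ⟨hfm, hsm⟩ := hrb (Mc - 1) le_rfl
        rw [hfcF] at hfm
        have h1 : 1 ≤ ω.2.firstHitG - (Mc - 1) := by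
          by_contra h0; push Not at h0
          have e0 : ω.2.firstHitG - (Mc - 1) = 0 := by omega
          rw [e0] at hsm; rw [hsm] at h0W; exact absurd h0W (by decide)
        have hp := ω.2.fc_pred_eq_of_sIn_S (show ω.2.firstHitG - (Mc - 1) < n by omega) h1 hsm
        rw [hfm] at hp
        have hpb : ω.2.fc (ω.2.firstHitG - (Mc - 1) - 1) = (r.1, Y') := by rw [hp]; exact Prod.ext rfl (by simp only; omega)
        have := hsvB _ (by omega) (hpb.trans hfcB.symm)
        omega
    -- the excursion starts east of the wall and ends west of it: it crosses the wall
    have hF1 : ω.2.firstHitG + 1 < n := by omega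
    obtain ⟨hfc1, -⟩ := ω.2.fc_succ_eq_of_sOut_E hF1 houtE
    obtain ⟨k, hk1, hk2, hkc⟩ := ω.2.exists_fst_eq_between' (i := ω.2.firstHitG + 1) (j := n - 1) (by omega) hn1 (x := r.1)
      (by rw [hfc1, hfcF]; simp only; omega) (by rw [hL]; simp only; omega)
    have := hwall_le k (by omega) hkc
    omega
  · ---------------------------------------------------------------- (B) `r` left downwards: the excursion descends the wall to `b`, then stays on one side of it
    have hfhMc : ω.2.firstHitG + (Mc - 1) < n := by
      by_contra hge
      push Not at hge
      have hrd := ω.2.run_down_of_straight (j := ω.2.firstHitG) (M := n - 1 - ω.2.firstHitG) (by omega) houtS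
        (fun m hm1 hmM i hi hfi => (hwall_straight m hm1 (by omega) i hi (by rw [hfi, hfcF])).2.1) (n - 1 - ω.2.firstHitG) le_rfl
      rw [show ω.2.firstHitG + (n - 1 - ω.2.firstHitG) = n - 1 by omega, hL, hfcF] at hrd
      have := congrArg Prod.fst hrd.1; simp only at this; omega
    have hrd := ω.2.run_down_of_straight (j := ω.2.firstHitG) (M := Mc - 1) hfhMc houtS
      (fun m hm1 hmM i hi hfi => (hwall_straight m hm1 (by omega) i hi (by rw [hfi, hfcF])).2.1)
    obtain ⟨hfm, hsm⟩ := hrd (Mc - 1) le_rfl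
    rw [hfcF] at hfm
    have hB1 : ω.2.firstHitG + (Mc - 1) + 1 < n := by
      by_contra h0
      have e0 : ω.2.firstHitG + (Mc - 1) = n - 1 := by omega
      rw [e0, hL] at hfm; have := congrArg Prod.fst hfm; simp only at this; omega
    have hs := ω.2.fc_succ_eq_of_sOut_S hB1 hsm
    rw [hfm] at hs
    have hsb : ω.2.fc (ω.2.firstHitG + (Mc - 1) + 1) = (r.1, Y') := by rw [hs]; exact Prod.ext rfl (by simp only; omega)
    have hiBeq : iB = ω.2.firstHitG + (Mc - 1) + 1 := (hsvB _ hB1 (hsb.trans hfcB.symm)).symm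
    -- indices of wall cells lie in `[firstHitG, iB]`
    have hwall_range : ∀ i < n, (ω.2.fc i).1 = r.1 → ω.2.firstHitG ≤ i ∧ i ≤ iB := by
      intro i hi hci
      rcases hwall_cases i hi hci with e | ⟨m, hm1, hmM, hfi⟩ | e
      · omega
      · obtain ⟨hfm', -⟩ := hrd m (by omega)
        rw [hfcF] at hfm'
        have := (hwall_straight m hm1 hmM i hi hfi).1 (ω.2.firstHitG + m) (by omega) (by rw [hfm', hfi])
        omega
      · omega
    -- `b` leaves horizontally
    have hbN : ω.2.sOut iB ≠ .N := by
      intro hN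
      have hiB1 : iB + 1 < n := by
        by_contra h0
        have e0 : iB = n - 1 := by omega
        rw [e0, hL] at hfcB; have := congrArg Prod.fst hfcB; simp only at this; omega
      have hs' := ω.2.fc_succ_eq_of_sOut_N hiB1 hN
      rw [hfcB] at hs'
      have := (hwall_range (iB + 1) hiB1 (by rw [hs'])).2
      omega
    have hbS : ω.2.sOut iB ≠ .S := (hSbot iB hiB (by rw [hfcB])).2
    have hbWE : ω.2.sOut iB = .W ∨ ω.2.sOut iB = .E := by
      revert hbN hbS; cases ω.2.sOut iB <;> decide
    have hiB1 : iB + 1 < n := by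
      by_contra h0
      have e0 : iB = n - 1 := by omega
      rw [e0, hL] at hfcB; have := congrArg Prod.fst hfcB; simp only at this; omega
    rcases hbWE with hbW | hbE
    · -- `b` left through `W`: afterwards the walk stays strictly west of the wall; the excursion never meets the eastern ray
      obtain ⟨hfcb1, -⟩ := ω.2.fc_succ_eq_of_sOut_W hiB1 hbW
      rw [hfcB] at hfcb1
      have hafter : ∀ i, iB < i → i < n → (ω.2.fc i).1 < r.1 := by
        intro i h1 h2
        by_contra hge; push Not at hge
        obtain ⟨k, hk1, hk2, hkc⟩ := ω.2.exists_fst_eq_between (i := iB + 1) (j := i) (by omega) h2 (x := r.1)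
          (by rw [hfcb1]; simp only; omega) hge
        have := (hwall_range k (by omega) hkc).2
        omega
      have hJwest : ∀ i, ω.2.firstHitG ≤ i → i < n → (ω.2.fc i).1 ≤ r.1 := by
        intro i h1 h2
        rcases le_or_gt i iB with hle | hgt
        · -- between the first hit and `b`: a wall cell
          rcases Nat.eq_or_lt_of_le h1 with e | hlt
          · rw [← e, hfcF]
          · rcases lt_or_eq_of_le hle with hlt2 | heq2
            · have hm : i - ω.2.firstHitG ≤ Mc - 1 := by omega
              obtain ⟨hfi, -⟩ := hrd (i - ω.2.firstHitG) hm
              rw [show ω.2.firstHitG + (i - ω.2.firstHitG) = i by omega, hfcF] at hfi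
              rw [hfi]
            · rw [heq2, hfcB]
        · exact (hafter i hgt h2).le
      have hray : ω.rayCountAt hr h (holeFaceW w) .E = 0 := by
        rw [rayCountAt_holeFaceW_E_eq_card_root ω hr h, Finset.card_eq_zero, Finset.filter_eq_empty_iff]
        intro j hj htrue
        rw [Finset.mem_range] at hj
        have hMv : ω.2.firstHitG + ω.Mv = n := fh_add_Mv h
        by_cases hjn : ω.2.firstHitG + j + 1 < n
        · obtain ⟨hin, -⟩ := ω.2.side_sIn_eq_nth hjn
          rw [← hin] at htrue
          have h1 := le_fst_of_eastRayB_side' htrue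
          have h2 := hJwest (ω.2.firstHitG + j + 1) (by omega) hjn
          omega
        · have e : ω.2.firstHitG + j + 1 = n := by omega
          rw [e, ω.2.nth_length] at htrue
          have := le_fst_of_eastRayB_side' htrue
          omega
      have hodd := (ω.AJ_root_ne_zero_iff_odd_rayCountAt (hr := hr) h (holeFaceW_side_E w)).1 hA
      rw [hray] at hodd
      exact absurd hodd (by decide)
    · -- `b` left through `E`: afterwards the walk stays strictly east of the wall, but it ends west of it
      obtain ⟨hfcb1, -⟩ := ω.2.fc_succ_eq_of_sOut_E hiB1 hbE
      rw [hfcB] at hfcb1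
      obtain ⟨k, hk1, hk2, hkc⟩ := ω.2.exists_fst_eq_between' (i := iB + 1) (j := n - 1) (by omega) hn1 (x := r.1)
        (by rw [hfcb1]; simp only; omega) (by rw [hL]; simp only; omega)
      have := (hwall_range k (by omega) hkc).2
      omega

/-- ★★★★ **NO COST-`7` VERTICAL-END PARENT WEST OF THE ROOT COLUMN, ABOVE THE ROW.** A wound class-`B2a` walk of limit cost `7` from the hole root `w.side W`
(hole `(w.1 − 1, w.2)` absent) ending on a vertical side of a rhombus `r` strictly above the root row, with a turning first arc in `r`, has `w.1 ≤ r.1`.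
[cite: GlazmanManolescu2019, §1, Fig. 1 and eq. (1); Lemma 2.1 (proof: the groups); Remark 2.2] [cite: Glazman2015WeightedSAW, Lemma 3.1 (proof, pp. 6–7)]
[cite: CourantRobbins1958, Ch. V Appendix §2 (the even–odd rule)] -/
theorem rootCol_le_of_cost_seven_vert_above (hh : holeFaceW w ∉ D) (hr : RootedFace D (w.side .W) r) (h : ω.IsB2a)
    (hA : ω.AJ hr h (toC (midPt (w.side .W))) ≠ 0) (hc : cost (slotOfSide ω.1) ω.2.mids = 7) (hz : ω.1 = .E ∨ ω.1 = .W)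
    (hNS : arcKind (ω.2.sIn ω.2.firstHitG) (ω.2.sOut ω.2.firstHitG) ≠ .straight) (habove : w.2 < r.2) : w.1 ≤ r.1 := by
  by_contra hlt
  push Not at hlt
  rcases hz with hE | hW
  · exact not_west_of_cost_seven_E_above hh hr h hA hc hE hNS habove hlt
  · exact not_west_of_cost_seven_W_above hh hr h hA hc hW hNS habove hlt

/-- ★★★★ **NO COST-`7` VERTICAL-END PARENT WEST OF THE ROOT COLUMN, BELOW THE ROW** — the row reflection of `rootCol_le_of_cost_seven_vert_above`.
[cite: GlazmanManolescu2019, §1, Fig. 1 and eq. (1); Lemma 2.1; §4.2 (lattice symmetries)] [cite: Glazman2015WeightedSAW, Lemma 3.1 (proof, pp. 6–7)]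
[cite: CourantRobbins1958, Ch. V Appendix §2 (the even–odd rule)] -/
theorem rootCol_le_of_cost_seven_vert_below (hh : holeFaceW w ∉ D) (hr : RootedFace D (w.side .W) r) (h : ω.IsB2a)
    (hA : ω.AJ hr h (toC (midPt (w.side .W))) ≠ 0) (hc : cost (slotOfSide ω.1) ω.2.mids = 7) (hz : ω.1 = .E ∨ ω.1 = .W)
    (hNS : arcKind (ω.2.sIn ω.2.firstHitG) (ω.2.sOut ω.2.firstHitG) ≠ .straight) (hbelow : r.2 < w.2) : w.1 ≤ r.1 := by
  have hh' : holeFaceW w ∉ rowMirrorDom w D := by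
    rw [mem_rowMirrorDom]
    have e : mirrorRowFace w.2 (holeFaceW w) = holeFaceW w := by
      simp only [mirrorRowFace, holeFaceW]; exact Prod.ext rfl (by simp only; ring)
    rw [e]; exact hh
  have hr' := rootedFace_rowMirrorDom_mirrorRowFace (w := w) hr
  have h' := isB2a_mirrorAt hr h
  have hA' := AJ_mirrorAt_ne_zero hr h hA
  have hc' : cost (slotOfSide ω.mirrorAt.1) ω.mirrorAt.2.mids = 7 := by
    show cost (slotOfSide (mirrorSide ω.1)) (ω.2.mids.map (mirrorRow w.2)) = 7
    rw [cost_map_mirrorRow]; exact hc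
  have hz' : ω.mirrorAt.1 = .E ∨ ω.mirrorAt.1 = .W := by
    show mirrorSide ω.1 = .E ∨ mirrorSide ω.1 = .W
    rcases hz with e | e <;> rw [e]
    · exact Or.inl rfl
    · exact Or.inr rfl
  have hF := ω.fh_lt h
  have hFm : ω.mirrorAt.2.firstHitG = ω.2.firstHitG := YBWalk.firstHitG_eq_of_mids_mirror ω.mirrorAt_mids
  have hNS' : arcKind (ω.mirrorAt.2.sIn ω.mirrorAt.2.firstHitG) (ω.mirrorAt.2.sOut ω.mirrorAt.2.firstHitG) ≠ .straight := by
    obtain ⟨e1, e2⟩ := YBWalk.sIn_sOut_eq_of_mids_mirror ω.mirrorAt_mids (i := ω.2.firstHitG) hF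
    rw [hFm, e1, e2, arcKind_mirrorSide]
    have hmk : ∀ k : ArcKind, mirrorKind k = .straight → k = .straight := by intro k; cases k <;> decide
    exact fun hk => hNS (hmk _ hk)
  have habove' : w.2 < (mirrorRowFace w.2 r).2 := by simp only [mirrorRowFace]; omega
  have key := rootCol_le_of_cost_seven_vert_above (ω := ω.mirrorAt) hh' hr' h' hA' hc' hz' hNS' habove'
  exact key

/-- ★★★★ **NO COST-`7` VERTICAL-END PARENT WEST OF THE ROOT COLUMN, OFF THE HOLE ROW**: for `r.2 ≠ w.2`, a wound class-`B2a` walk of limit cost `7` from the hole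
root ending on a vertical side of `r` with a turning first arc in `r` has `w.1 ≤ r.1` — so its class-`B2b` extension, a level-`5` member, lives in the root column or
east of it. [cite: GlazmanManolescu2019, §1, Fig. 1 and eq. (1); Lemma 2.1 (proof: the groups); Remark 2.2] [cite: Glazman2015WeightedSAW, Lemma 3.1 (proof, pp. 6–7)]
[cite: CourantRobbins1958, Ch. V Appendix §2 (the even–odd rule)] -/
theorem rootCol_le_of_cost_seven_vert_off_row (hh : holeFaceW w ∉ D) (hr : RootedFace D (w.side .W) r) (h : ω.IsB2a)
    (hA : ω.AJ hr h (toC (midPt (w.side .W))) ≠ 0) (hc : cost (slotOfSide ω.1) ω.2.mids = 7) (hz : ω.1 = .E ∨ ω.1 = .W)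
    (hNS : arcKind (ω.2.sIn ω.2.firstHitG) (ω.2.sOut ω.2.firstHitG) ≠ .straight) (hrow : r.2 ≠ w.2) : w.1 ≤ r.1 := by
  rcases lt_or_gt_of_ne hrow with hlt | hgt
  · exact rootCol_le_of_cost_seven_vert_below hh hr h hA hc hz hNS hlt
  · exact rootCol_le_of_cost_seven_vert_above hh hr h hA hc hz hNS hgt

end ΩG

end Literature.Probability.RandomPlanarGeometry.SAW.YangBaxter
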